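import Literature.NumberTheory.Automorphic.CuspidalCohomologyGLRankOneProofs
import Literature.NumberTheory.Automorphic.CuspidalCohomologyGLRankOneCharacter
import Literature.NumberTheory.GaloisRepresentations.HeckeCharacterOfRayClass
import HarnessLib

/-!
# Interior eigenclasses for `GL_1 / ℚ` are cuspidal automorphic: the rank-one case of
# `interiorEigenclass_isCuspidal`

Topic `NumberTheory/Automorphic`; proof file (theorems only: no definition, no named fact, no
instance) under the named fact
`Literature.NumberTheory.Automorphic.GLnCohomology.interiorEigenclass_isCuspidal`
(`CuspidalCohomologyGL`: for regular `λ` or `n ≤ 2`, every non-zero simultaneous Hecke eigenclass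
in `H^{b_n}_!(S(K_f(N)), Ṽ_λ ⊗ ℂ)` has the Satake eigenvalues of a cuspidal automorphic
representation of `GL_n(𝔸_ℚ)` of cohomological infinity type `cohomologicalInfinityType n ℚ λ^∨`
with a `K(N)`-fixed vector; Franke, Borel–Garland, Mœglin–Waldspurger, Wigner, as summarised in
[Kishore2020, §5–§6]).  For general `n` the printed proof goes through the comparison
`H^•(S(K_f), Ṽ_λ) = H^•(𝔤, K_∞; 𝒜 ⊗ V_λ)` and the description of the discrete spectrum of `GL_n`,
a theory the tree does not have.  This file proves the **rank-one case `n = 1`**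
(`GLnCohomology.interiorEigenclass_isCuspidal_one`, the fact's statement with `n := 1`, binders
verbatim) — the converse of the tree's `GLnCohomology.cuspidalEigenclass_exists_one`
(`CuspidalCohomologyGLRankOneHolds`).  Here `b_1 = 0`,
`S(K_f(N)) = ℚ^×_{>0} \ 𝔸_{ℚ,f}^× / K_f(N)` is the ray class set, the coefficient system
`V_λ`, `λ = (λ₀)`, is the character `det^{λ₀}`, and the statement becomes: a non-zero function `f`
on `𝔸_{ℚ,f}^× / K_f(N)` with `f(γ c) = γ^{λ₀} f(c)` (`γ ∈ ℚ^×_{>0}`) which is an eigenfunction of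
the translations by the uniformisers `ϖ_v`, `v ∤ N`, is a multiple of the finite part of an
algebraic idèle class character `θ` of `ℚ` with `θ_∞(t) = t^{-λ₀}` on `ℝ_{>0}`, and
`π_θ = ℂ · (θ ∘ det)` is the cuspidal automorphic representation of `GL₁(𝔸_ℚ)` sought
(Eichler–Shimura–Harder in degree `0`: [RaghuramShahidi2010, §2.2] with `n = 1`).

## Main results

* `TwistedQuotient.H0Iso_hom_heckeEnd`, `TwistedQuotient.heckeFun_H0Iso_hom_eq_smul` — classes in
  `H⁰(Γ, Fun(𝒢 ⧸ L, V))` are invariant functions (Mathlib `groupCohomology.H0Iso`) on which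
  `T_g = [L g L]` acts by the double-coset sum; eigenclasses give eigenfunctions.
* `TwistedQuotient.exists_character_of_eigenfunction` — a non-zero function on `𝒢 ⧸ L` on which
  a generating set of `𝒢` acts by scalars under right translation transforms by a character
  `χ : 𝒢 → kˣ` trivial on `L`.
* `finiteIdele_rat_subgroup_eq_top`, `GLnCohomology.subgroup_finiteAdelicGL_one_eq_top` —
  **`GL_1(𝔸_{ℚ,f}) = GL_1(ℚ)⁺ · K_f(N) · ⟨t_{v,1} : v ∤ N⟩`** (weak approximation at `N∞`,
  `exists_principalIdele_mul_mem_congruenceIdeles`, then division by uniformisers;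
  `GLnCohomology.scalar_mem_level`: unit ideles `≡ 1 mod N` lie in `K_f(N)`).
* `GLnCohomology.exists_character_of_eigenclass_one` — **the character of a rank-one eigenclass**:
  a non-zero `x ∈ H⁰(S(K_f(N)), Ṽ_λ(k))` which is an eigenvector of the `T_{v,1}`, `v ∤ N`, is acted
  on by every `T_g` through a character `χ` of `GL_1(𝔸_{ℚ,f})`, trivial on `K_f(N)`, with
  `χ(γ) = γ^{λ₀}` on `GL_1(ℚ)⁺`.
* `exists_heckeCharacter_rat_of_finitePart` — **the algebraic Hecke character of `ℚ` with given
  finite part**: for a character `χ` of `(𝔸_{ℚ,f})^×` trivial on the unit ideles `≡ 1 mod N` with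
  `χ(q) = q^w` on `ℚ_{>0}`, `θ(x) = |x_∞|^{-w} χ(sgn(x_∞) x_f)` is an idèle class character with
  `θ((1, u)) = χ(u)` and `θ((t, 1)) = t^{-w}` (`t > 0`).
* `GLnCohomology.interiorEigenclass_isCuspidal_rank_one`, `…_one` — **the fact for `n = 1`**:
  assembly with the tree's Borel–Jacquet dictionary for `GL(1)`
  (`exists_automorphicRepData_detTwist_glOne`, `AutomorphicRepData.hasSatakeParamAt_detTwist_glOne`
  of `GLOneOfHeckeCharacterBJ`; the
  archimedean parameter via `AutomorphicRepData.hasArchParameter_glOne_of_eq_smul_one` and the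
  differential of `θ` along `A_G`, `exists_linearMap_detTwist_ofArch_expMem_glOne`).

Only `n = 1` is treated; for `n = 2` (Eichler–Shimura) and `n ≥ 3`, `λ` regular (Franke,
Mœglin–Waldspurger, Li–Schwermer) the fact remains a named fact.

## References

* K. Kishore, *Inner cohomology of GL_n*, J. Number Theory 209 (2020), §5–§6
  (doi:10.1016/j.jnt.2019.08.021) [Kishore2020].
* A. Raghuram, F. Shahidi, *On certain period relations for cusp forms on `GL_n`*, Int. Math.
  Res. Not. IMRN 2008, Art. ID rnn077, §2.2 [RaghuramShahidi2010].
* A. Borel, H. Jacquet, *Automorphic forms and automorphic representations*, Proc. Sympos. Pure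
  Math. 33 (Corvallis 1979), Part 1, §4.4–4.6 [BorelJacquet1979].
* J. W. S. Cassels, A. Fröhlich (eds.), *Algebraic Number Theory* (1967), Ch. VII (Tate), §4,
  Prop. 4.1 (proof: weak approximation) [CasselsFrohlichANT1967].
* J. Neukirch, *Algebraic Number Theory*, Ch. VII §6 (idèle class characters and their infinity
  components) [NeukirchANT1999].
* G. Shimura, *Introduction to the arithmetic theory of automorphic functions* (1971), Ch. 3,
  §3.1 [ShimuraIATAF1971].
-/

noncomputable section

open CategoryTheory
open scoped Classical
open NumberField IsDedekindDomain

universe u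

namespace Literature.NumberTheory.Automorphic

/-! ### `H⁰`-classes are invariant functions; Hecke operators act by the double-coset sums -/

namespace TwistedQuotient

open groupCohomology

variable {k : Type u} [CommRing k] {Γ 𝒢 : Type u} [Group Γ] [Group 𝒢]
variable (ι : Γ →* 𝒢) (L : Subgroup 𝒢) {V : Type u} [AddCommGroup V] [Module k V]
  (ρ : Representation k Γ V)

/-- **Classes in `H⁰` are invariant functions.** For `x ∈ H⁰(Γ, Fun(𝒢 ⧸ L, V))` the function
`f = H0Iso x ∈ Fun(𝒢 ⧸ L, V)^Γ` is invariant for the twisted action, vanishes only if `x = 0`, and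
the Hecke operator `T_g = [L g L]` acts on it by the double-coset operator `heckeFun`
(Mathlib `groupCohomology.H0Iso`, `map_id_comp_H0Iso_hom`). [folklore] -/
theorem H0Iso_hom_heckeEnd (g : 𝒢) (x : cohomology ι L ρ 0) :
    (((H0Iso (coeffRep ι L ρ)).hom (heckeEnd ι L ρ g 0 x) : (coeffRep ι L ρ).ρ.invariants) :
        (𝒢 ⧸ L) → V) =
      ArithmeticQuotient.heckeFun k L g V
        (((H0Iso (coeffRep ι L ρ)).hom x : (coeffRep ι L ρ).ρ.invariants) : (𝒢 ⧸ L) → V) := by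
  change ((((H0Iso (coeffRep ι L ρ)).hom ((groupCohomology.map (MonoidHom.id Γ)
      (heckeRepHom ι L ρ g) 0) x)) : (coeffRep ι L ρ).ρ.invariants) : (𝒢 ⧸ L) → V) = _
  rw [map_id_comp_H0Iso_hom_apply]
  rfl

/-- The invariant function of a class: `H0Iso x` is fixed by the twisted action. [folklore] -/
theorem coeffRepresentation_H0Iso_hom (x : cohomology ι L ρ 0) (γ : Γ) :
    coeffRepresentation ι L ρ γ
        (((H0Iso (coeffRep ι L ρ)).hom x : (coeffRep ι L ρ).ρ.invariants) : (𝒢 ⧸ L) → V) =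
      (((H0Iso (coeffRep ι L ρ)).hom x : (coeffRep ι L ρ).ρ.invariants) : (𝒢 ⧸ L) → V) :=
  ((H0Iso (coeffRep ι L ρ)).hom x).2 γ

/-- A non-zero class has a non-zero invariant function. [folklore] -/
theorem H0Iso_hom_ne_zero {x : cohomology ι L ρ 0} (hx : x ≠ 0) :
    (((H0Iso (coeffRep ι L ρ)).hom x : (coeffRep ι L ρ).ρ.invariants) : (𝒢 ⧸ L) → V) ≠ 0 := by
  intro h
  apply hx
  have h' : (H0Iso (coeffRep ι L ρ)).hom x = 0 := Subtype.ext h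
  have hinj : Function.Injective (H0Iso (coeffRep ι L ρ)).hom :=
    (H0Iso (coeffRep ι L ρ)).toLinearEquiv.injective
  exact hinj (by rw [h', map_zero])

/-- **Eigenclasses give eigenfunctions**: if `T_g x = c • x` in `H⁰` then the invariant function
`f` of `x` satisfies `[L g L] f = c • f`. [folklore] -/
theorem heckeFun_H0Iso_hom_eq_smul {g : 𝒢} {x : cohomology ι L ρ 0} {c : k}
    (h : heckeEnd ι L ρ g 0 x = c • x) :
    ArithmeticQuotient.heckeFun k L g V
        (((H0Iso (coeffRep ι L ρ)).hom x : (coeffRep ι L ρ).ρ.invariants) : (𝒢 ⧸ L) → V) =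
      c • (((H0Iso (coeffRep ι L ρ)).hom x : (coeffRep ι L ρ).ρ.invariants) : (𝒢 ⧸ L) → V) := by
  rw [← H0Iso_hom_heckeEnd, h, map_smul]
  rfl

end TwistedQuotient

/-! ### Eigenfunctions of translations in a commutative group are governed by a character -/

namespace TwistedQuotient

variable {k : Type u} [Field k] {𝒢 : Type u} [Group 𝒢]
variable (L : Subgroup 𝒢) {V : Type u} [AddCommGroup V] [Module k V]

/-- **The character of a simultaneous eigenfunction.** Let `f : 𝒢 ⧸ L → V` be non-zero and let
`G ⊆ 𝒢` generate `𝒢`. If every `g ∈ G` acts on `f` by a scalar under right translation,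
`f(a g L) = c_g • f(a L)` for all `a`, then there is a character `χ : 𝒢 →* kˣ`, trivial on `L`,
with `f(a g L) = χ(g) • f(a L)` for all `a, g ∈ 𝒢`, and `χ(g)` is the only such scalar (the `g`
acting by scalars form a subgroup — the scalar of `g` is non-zero since `f ≠ 0` — containing `G`;
the scalars are unique and multiplicative). [folklore] -/
theorem exists_character_of_eigenfunction (f : (𝒢 ⧸ L) → V) (hf0 : f ≠ 0) (G : Set 𝒢)
    (hgen : Subgroup.closure G = ⊤)
    (hG : ∀ g ∈ G, ∃ c : k, ∀ a : 𝒢, f ((a * g : 𝒢) : 𝒢 ⧸ L) = c • f (a : 𝒢 ⧸ L)) :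
    ∃ χ : 𝒢 →* kˣ, (∀ u ∈ L, χ u = 1) ∧
      (∀ g a : 𝒢, f ((a * g : 𝒢) : 𝒢 ⧸ L) = ((χ g : kˣ) : k) • f (a : 𝒢 ⧸ L)) ∧
      ∀ (g : 𝒢) (d : k), (∀ a : 𝒢, f ((a * g : 𝒢) : 𝒢 ⧸ L) = d • f (a : 𝒢 ⧸ L)) →
        d = ((χ g : kˣ) : k) := by
  -- a point where `f` does not vanish
  obtain ⟨a₀, ha₀⟩ : ∃ a₀ : 𝒢, f (a₀ : 𝒢 ⧸ L) ≠ 0 := by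
    by_contra h
    push Not at h
    apply hf0
    funext q
    induction q using QuotientGroup.induction_on with
    | H a => exact h a
  -- the subgroup of elements acting by scalars
  let S : Subgroup 𝒢 :=
    { carrier := {g | ∃ c : k, ∀ a : 𝒢, f ((a * g : 𝒢) : 𝒢 ⧸ L) = c • f (a : 𝒢 ⧸ L)}
      one_mem' := ⟨1, fun a => by rw [mul_one, one_smul]⟩
      mul_mem' := by
        rintro g h ⟨c, hc⟩ ⟨d, hd⟩
        exact ⟨d * c, fun a => by rw [← mul_assoc, hd, hc, smul_smul]⟩
      inv_mem' := by
        rintro g ⟨c, hc⟩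
        have hc0 : c ≠ 0 := by
          intro h0
          apply ha₀
          have h1 := hc (a₀ * g⁻¹)
          rw [inv_mul_cancel_right, h0, zero_smul] at h1
          exact h1
        refine ⟨c⁻¹, fun a => ?_⟩
        have h1 := hc (a * g⁻¹)
        rw [inv_mul_cancel_right] at h1
        rw [h1, smul_smul, inv_mul_cancel₀ hc0, one_smul] }
  have hS : S = ⊤ := by
    rw [eq_top_iff, ← hgen]
    exact (Subgroup.closure_le S).mpr hG
  have hall : ∀ g : 𝒢, ∃ c : k, ∀ a : 𝒢, f ((a * g : 𝒢) : 𝒢 ⧸ L) = c • f (a : 𝒢 ⧸ L) :=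
    fun g => by
      have hg : g ∈ S := by rw [hS]; exact Subgroup.mem_top g
      exact hg
  choose c hc using hall
  -- uniqueness of the scalars
  have huniq : ∀ (g : 𝒢) (d : k),
      (∀ a : 𝒢, f ((a * g : 𝒢) : 𝒢 ⧸ L) = d • f (a : 𝒢 ⧸ L)) → d = c g := by
    intro g d hd
    have h2 := hc g a₀
    rw [hd a₀] at h2
    exact smul_left_injective k ha₀ h2
  have h1 : c 1 = 1 := (huniq 1 1 fun a => by rw [mul_one, one_smul]).symm
  have hmul : ∀ g h, c (g * h) = c g * c h := fun g h =>
    (huniq (g * h) (c g * c h) fun a => by rw [← mul_assoc, hc h, hc g, smul_smul, mul_comm]).symm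
  let c' : 𝒢 →* k := { toFun := c, map_one' := h1, map_mul' := hmul }
  refine ⟨c'.toHomUnits, fun u hu => Units.ext ?_, fun g a => hc g a, fun g d hd => huniq g d hd⟩
  change c u = 1
  exact (huniq u 1 fun a => by rw [one_smul, QuotientGroup.mk_mul_of_mem a hu]).symm

end TwistedQuotient

/-! ### `GL_1(𝔸_{ℚ,f})` is generated by `ℚ^×_{>0}`, `K_f(N)` and the uniformisers at `v ∤ N` -/

section Generation

open Literature.NumberTheory.GaloisRepresentations
open BigHeckeGLn (uniformizerAt)

variable {K : Type} [Field K] [NumberField K]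

/-- Components of a product of powers of the uniformiser ideles `(ϖ_v at v, 1 elsewhere)`:
`ϖ_w^{e_w}` at `w ∈ T`, `1` at `w ∉ T`. [folklore] -/
theorem coe_prod_uniformizerIdele_zpow_apply (T : Finset (HeightOneSpectrum (𝓞 K)))
    (e : HeightOneSpectrum (𝓞 K) → ℤ) (w : HeightOneSpectrum (𝓞 K)) :
    ((∏ v ∈ T, uniformizerIdele K v (uniformizerAt v) ^ e v : (FiniteAdeleRing (𝓞 K) K)ˣ) :
        FiniteAdeleRing (𝓞 K) K) w =
      if w ∈ T then ((uniformizerAt w : (w.adicCompletion K)ˣ) : w.adicCompletion K) ^ e w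
      else 1 := by
  classical
  let φ : (FiniteAdeleRing (𝓞 K) K)ˣ →* w.adicCompletion K :=
    (AdelicGroupData.finiteAdeleEval K w).toMonoidHom.comp (Units.coeHom (FiniteAdeleRing (𝓞 K) K))
  have hφ : ∀ z : (FiniteAdeleRing (𝓞 K) K)ˣ, φ z = (z : FiniteAdeleRing (𝓞 K) K) w := fun z => rfl
  rw [← hφ, map_prod]
  simp_rw [map_zpow, hφ]
  by_cases hw : w ∈ T
  · rw [if_pos hw, Finset.prod_eq_single_of_mem w hw fun b _ hbw => ?_]
    · rw [uniformizerIdele_apply_self]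
    · rw [uniformizerIdele_apply_of_ne K b _ (Ne.symm hbw), one_zpow]
  · rw [if_neg hw]
    exact Finset.prod_eq_one fun b hb => by
      have hwb : w ≠ b := fun h => hw (h ▸ hb)
      rw [uniformizerIdele_apply_of_ne K b _ hwb, one_zpow]

/-- Valuations of the components of a product of powers of uniformiser ideles:
`exp (-e_w)` at `w ∈ T`, `1` elsewhere. [folklore] -/
theorem valued_coe_prod_uniformizerIdele_zpow_apply (T : Finset (HeightOneSpectrum (𝓞 K)))
    (e : HeightOneSpectrum (𝓞 K) → ℤ) (w : HeightOneSpectrum (𝓞 K)) :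
    Valued.v (((∏ v ∈ T, uniformizerIdele K v (uniformizerAt v) ^ e v :
        (FiniteAdeleRing (𝓞 K) K)ˣ) : FiniteAdeleRing (𝓞 K) K) w) =
      if w ∈ T then WithZero.exp (-(e w)) else 1 := by
  rw [coe_prod_uniformizerIdele_zpow_apply]
  split_ifs
  · rw [map_zpow₀, BigHeckeGLn.valued_uniformizerAt, ← WithZero.exp_zsmul, smul_eq_mul, mul_neg,
      mul_one]
  · exact map_one _

/-- **`(𝔸_{ℚ,f})^× = ℚ^×_{>0} · U_𝔣 · ⟨ϖ_v : v ∤ 𝔣⟩`.** A subgroup of the finite ideles of `ℚ`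
containing the positive rationals (diagonally), the unit ideles congruent to `1 mod 𝔣`, and the
uniformiser ideles `(ϖ_v at v, 1 elsewhere)` at the places `v ∤ 𝔣` (`𝔣 ≠ 0`) is everything:
for a finite idele `u`, weak approximation (`exists_principalIdele_mul_mem_congruenceIdeles`,
Cassels–Fröhlich VII §4.1) gives `a ∈ ℚ^×` with `a · (1, u)` positive at `∞` (so `a > 0`) and
`≡ 1 mod 𝔣`; dividing `a u` by `∏_{v ∤ 𝔣} ϖ_v^{ord_v(a u)}` leaves a unit idele `≡ 1 mod 𝔣`.
(Class number one and `ℤ^× = {±1}` are not used explicitly: they are hidden in the positivity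
at the real place.) [cite: CasselsFrohlichANT1967, Ch. VII §4 Prop. 4.1 (proof)] -/
theorem finiteIdele_rat_subgroup_eq_top {𝔣 : Ideal (𝓞 ℚ)} (h𝔣 : 𝔣 ≠ ⊥)
    (S : Subgroup (FiniteAdeleRing (𝓞 ℚ) ℚ)ˣ)
    (hQ : ∀ q : ℚˣ, 0 < (q : ℚ) → FiniteAdeleRing.unitEmbedding (𝓞 ℚ) ℚ q ∈ S)
    (hU : ∀ u : (FiniteAdeleRing (𝓞 ℚ) ℚ)ˣ,
      (∀ v, Valued.v ((u : FiniteAdeleRing (𝓞 ℚ) ℚ) v) = 1) →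
      (∀ v, modulusExp 𝔣 v ≠ 0 →
        Valued.v ((u : FiniteAdeleRing (𝓞 ℚ) ℚ) v - 1) ≤ WithZero.exp (-(modulusExp 𝔣 v : ℤ))) →
      u ∈ S)
    (hT : ∀ v, modulusExp 𝔣 v = 0 → uniformizerIdele ℚ v (uniformizerAt v) ∈ S) :
    S = ⊤ := by
  classical
  refine eq_top_iff.2 fun u _ => ?_
  -- the idele `x = (1, u)` and a principal idele moving it into `W_𝔣`
  let x : ideleGroup ℚ :=
    (MulEquiv.prodUnits (M := InfiniteAdeleRing ℚ) (N := FiniteAdeleRing (𝓞 ℚ) ℚ)).symm (1, u)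
  have hx1 : (x : AdeleRing (𝓞 ℚ) ℚ).1 = 1 := rfl
  have hx2 : ∀ v, (x : AdeleRing (𝓞 ℚ) ℚ).2 v = (u : FiniteAdeleRing (𝓞 ℚ) ℚ) v := fun v => rfl
  obtain ⟨a, ha⟩ := exists_principalIdele_mul_mem_congruenceIdeles h𝔣 x
  -- `a > 0` (positivity at the real place)
  have ha0 : 0 < (a : ℚ) := by
    have h := ha.2 Rat.infinitePlace Rat.isReal_infinitePlace
    rw [ideleGroup_val_fst_mul, hx1, mul_one, principalIdele_fst,
      InfiniteAdeleRing.algebraMap_apply, InfinitePlace.Completion.extensionEmbeddingOfIsReal_coe,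
      eq_ratCast] at h
    simpa using h
  -- the finite idele `Y = a u` and its orders
  set Y : (FiniteAdeleRing (𝓞 ℚ) ℚ)ˣ := FiniteAdeleRing.unitEmbedding (𝓞 ℚ) ℚ a * u with hY
  have hYv : ∀ v, (Y : FiniteAdeleRing (𝓞 ℚ) ℚ) v =
      ((principalIdele ℚ a * x : ideleGroup ℚ) : AdeleRing (𝓞 ℚ) ℚ).2 v := fun v => rfl
  have hcong : ∀ v, modulusExp 𝔣 v ≠ 0 →
      Valued.v ((Y : FiniteAdeleRing (𝓞 ℚ) ℚ) v - 1) ≤ WithZero.exp (-(modulusExp 𝔣 v : ℤ)) :=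
    fun v hv => by rw [hYv]; exact ha.1 v hv
  have hord𝔣 : ∀ v, modulusExp 𝔣 v ≠ 0 → FiniteAdeleRing.unitOrd (𝓞 ℚ) ℚ Y v = 0 := by
    intro v hv
    rw [FiniteAdeleRing.unitOrd_eq_zero_iff]
    have hlt : Valued.v ((Y : FiniteAdeleRing (𝓞 ℚ) ℚ) v - 1) < 1 := by
      refine (hcong v hv).trans_lt ?_
      rw [← WithZero.exp_zero, WithZero.exp_lt_exp, neg_lt_zero, Int.natCast_pos]
      exact Nat.pos_of_ne_zero hv
    have h := Valuation.map_eq_of_sub_lt Valued.v (x := (1 : v.adicCompletion ℚ))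
      (y := (Y : FiniteAdeleRing (𝓞 ℚ) ℚ) v) (by rw [map_one]; exact hlt)
    rwa [map_one] at h
  have hfin : {v : HeightOneSpectrum (𝓞 ℚ) | ¬ FiniteAdeleRing.unitOrd (𝓞 ℚ) ℚ Y v = 0}.Finite :=
    Filter.eventually_cofinite.1 (FiniteAdeleRing.unitOrd_eventually_eq_zero Y)
  set T : Finset (HeightOneSpectrum (𝓞 ℚ)) := hfin.toFinset with hT'
  have hTmem : ∀ v, v ∈ T ↔ FiniteAdeleRing.unitOrd (𝓞 ℚ) ℚ Y v ≠ 0 := fun v => by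
    rw [hT', Set.Finite.mem_toFinset, Set.mem_setOf_eq]
  have hT𝔣 : ∀ v ∈ T, modulusExp 𝔣 v = 0 := fun v hv => by
    by_contra h
    exact (hTmem v).1 hv (hord𝔣 v h)
  -- the product of uniformisers and the unit part
  set P : (FiniteAdeleRing (𝓞 ℚ) ℚ)ˣ :=
    ∏ v ∈ T, uniformizerIdele ℚ v (uniformizerAt v) ^ FiniteAdeleRing.unitOrd (𝓞 ℚ) ℚ Y v with hP
  have hPS : P ∈ S := prod_mem fun v hv => zpow_mem (hT v (hT𝔣 v hv)) _
  set z : (FiniteAdeleRing (𝓞 ℚ) ℚ)ˣ := Y * P⁻¹ with hz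
  have hzv : ∀ w, (z : FiniteAdeleRing (𝓞 ℚ) ℚ) w =
      (Y : FiniteAdeleRing (𝓞 ℚ) ℚ) w * (((P : FiniteAdeleRing (𝓞 ℚ) ℚ) w))⁻¹ := fun w => by
    have h := map_units_inv (AdelicGroupData.finiteAdeleEval ℚ w) P
    rw [AdelicGroupData.finiteAdeleEval_apply, AdelicGroupData.finiteAdeleEval_apply] at h
    rw [hz, Units.val_mul, ← h]
    rfl
  have hz1 : ∀ w, Valued.v ((z : FiniteAdeleRing (𝓞 ℚ) ℚ) w) = 1 := by
    intro w
    rw [hzv, map_mul, map_inv₀, hP, valued_coe_prod_uniformizerIdele_zpow_apply,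
      FiniteAdeleRing.valued_apply_eq_exp_neg_unitOrd]
    by_cases hw : w ∈ T
    · rw [if_pos hw, mul_inv_cancel₀ WithZero.exp_ne_zero]
    · rw [if_neg hw, inv_one, mul_one, WithZero.exp_eq_one, neg_eq_zero]
      exact not_not.1 ((hTmem w).not.1 hw)
  have hz2 : ∀ w, modulusExp 𝔣 w ≠ 0 →
      Valued.v ((z : FiniteAdeleRing (𝓞 ℚ) ℚ) w - 1) ≤ WithZero.exp (-(modulusExp 𝔣 w : ℤ)) := by
    intro w hw
    have hwT : w ∉ T := fun h => hw (hT𝔣 w h)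
    rw [hzv, hP, coe_prod_uniformizerIdele_zpow_apply, if_neg hwT, inv_one, mul_one]
    exact hcong w hw
  have hzS : z ∈ S := hU z hz1 hz2
  -- conclude
  have hu : u = (FiniteAdeleRing.unitEmbedding (𝓞 ℚ) ℚ a)⁻¹ * (z * P) := by
    rw [hz, inv_mul_cancel_right, hY, inv_mul_cancel_left]
  rw [hu]
  exact S.mul_mem (S.inv_mem (hQ a ha0)) (S.mul_mem hzS hPS)

end Generation

namespace GLnCohomology

open Literature.NumberTheory.GaloisRepresentations
open Literature.NumberTheory.DiophantineGeometry
open BigHeckeGLn (uniformizerAt)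

/-- Entries of a scalar element of `GL_1`. [folklore] -/
theorem coe_scalar_fin_one_apply {R : Type*} [CommRing R] (u : Rˣ) (i j : Fin 1) :
    ((Matrix.GeneralLinearGroup.scalar (Fin 1) u : GL (Fin 1) R) : Matrix (Fin 1) (Fin 1) R) i j =
      u := by
  rw [Subsingleton.elim i 0, Subsingleton.elim j 0, Matrix.GeneralLinearGroup.coe_scalar,
    Matrix.scalar_apply, Matrix.diagonal_apply_eq]

/-- **Unit ideles `≡ 1 mod N` lie in the level `K_f(N)`**: for a finite idele `u` of `ℚ` which
is a unit at every place and satisfies `|u_v - 1|_v ≤ |N|_v` at the primes `v ∣ N` (`N ≠ 0`), the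
scalar `u ∈ GL_1(𝔸_{ℚ,f})` lies in `K_f(N) = finitePrincipalCongruenceLevel 1 ℚ (N)`
(unfolding of the tree's `principalCongruenceLevel`: integrality of `u^{±1}` and the valued
congruence condition of radius `|N|_v = exp(-ord_v N)`, which is `1` at `v ∤ N`). [folklore] -/
theorem scalar_mem_level {N : ℕ} (hN : N ≠ 0) {u : (FiniteAdeleRing (𝓞 ℚ) ℚ)ˣ}
    (hu1 : ∀ v, Valued.v ((u : FiniteAdeleRing (𝓞 ℚ) ℚ) v) = 1)
    (hu2 : ∀ v, modulusExp (Ideal.span {(N : 𝓞 ℚ)}) v ≠ 0 →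
      Valued.v ((u : FiniteAdeleRing (𝓞 ℚ) ℚ) v - 1) ≤
        WithZero.exp (-(modulusExp (Ideal.span {(N : 𝓞 ℚ)}) v : ℤ))) :
    Matrix.GeneralLinearGroup.scalar (Fin 1) u ∈ level 1 N := by
  set 𝔣 : Ideal (𝓞 ℚ) := Ideal.span {(N : 𝓞 ℚ)} with h𝔣def
  have h𝔣b : 𝔣 ≠ ⊥ := by
    rw [Ne, h𝔣def, Ideal.span_singleton_eq_bot]
    exact_mod_cast hN
  have h𝔣 : 𝔣 ≠ 0 := by rwa [Ne, Ideal.zero_eq_bot]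
  have hinv : ∀ v, ((u⁻¹ : (FiniteAdeleRing (𝓞 ℚ) ℚ)ˣ) : FiniteAdeleRing (𝓞 ℚ) ℚ) v =
      ((u : FiniteAdeleRing (𝓞 ℚ) ℚ) v)⁻¹ := fun v => by
    have h := map_units_inv (AdelicGroupData.finiteAdeleEval ℚ v) u
    rwa [AdelicGroupData.finiteAdeleEval_apply, AdelicGroupData.finiteAdeleEval_apply] at h
  have hu1' : ∀ v,
      Valued.v (((u⁻¹ : (FiniteAdeleRing (𝓞 ℚ) ℚ)ˣ) : FiniteAdeleRing (𝓞 ℚ) ℚ) v) = 1 :=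
    fun v => by rw [hinv, map_inv₀, hu1, inv_one]
  have hint : Matrix.GeneralLinearGroup.scalar (Fin 1) u ∈ glFiniteIntegralLevel 1 ℚ := by
    rw [mem_glFiniteIntegralLevel_iff, ← map_inv]
    refine ⟨fun i j => ?_, fun i j => ?_⟩
    · rw [coe_scalar_fin_one_apply, mem_integralFiniteAdeles_iff]
      exact fun v => (HeightOneSpectrum.mem_adicCompletionIntegers (R := 𝓞 ℚ) ℚ v).2 (hu1 v).le
    · rw [coe_scalar_fin_one_apply, mem_integralFiniteAdeles_iff]
      exact fun v => (HeightOneSpectrum.mem_adicCompletionIntegers (R := 𝓞 ℚ) ℚ v).2 (hu1' v).le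
  rw [mem_finitePrincipalCongruenceLevel_iff, mem_principalCongruenceLevel_iff]
  refine ⟨GLn.ofFinite_mem_glIntegralLevel hint, fun v => ?_⟩
  change Matrix.GeneralLinearGroup.map (AdelicGroupData.adeleEval ℚ v)
    (GLn.ofFinite 1 ℚ (Matrix.GeneralLinearGroup.scalar (Fin 1) u)) ∈
      valuedCongruenceSubgroup (Fin 1) (idealRadius ℚ v 𝔣)
  rw [mem_valuedCongruenceSubgroup_iff]
  refine ⟨fun i j => ?_, fun i j => ?_, fun i j => ?_⟩
  · rw [coe_map_adeleEval_ofFinite_apply, coe_scalar_fin_one_apply, hu1]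
  · rw [← map_inv, ← map_inv, ← map_inv, coe_map_adeleEval_ofFinite_apply, coe_scalar_fin_one_apply,
      hu1']
  · rw [Matrix.sub_apply, coe_map_adeleEval_ofFinite_apply, coe_scalar_fin_one_apply,
      Subsingleton.elim i j, Matrix.one_apply_eq]
    by_cases hv : modulusExp 𝔣 v = 0
    · have hdvd : ¬ v.asIdeal ∣ 𝔣 := fun h =>
        (modulusExp_ne_zero_iff 𝔣 h𝔣b v).2 (Ideal.le_of_dvd h) hv
      rw [idealRadius_eq_one_of_not_dvd h𝔣 hdvd]
      refine (Valuation.map_sub _ _ _).trans ?_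
      rw [hu1, map_one, max_self]
    · rw [idealRadius, FractionalIdeal.count_coe ℚ v h𝔣]
      exact hu2 v hv

/-- A positive rational `q`, as the element `(q) ∈ GL_1(ℚ)⁺`. [folklore] -/
theorem scalar_mem_glpos {q : ℚˣ} (hq : 0 < (q : ℚ)) :
    Matrix.GeneralLinearGroup.scalar (Fin 1) q ∈ Matrix.GLPos (Fin 1) ℚ :=
  (Matrix.mem_glpos _).2 (by
    rw [Matrix.GeneralLinearGroup.val_det_apply, Matrix.det_fin_one, coe_scalar_fin_one_apply]
    exact hq)

/-- The principal finite idele of a positive rational `q`, as a scalar in `GL_1(𝔸_{ℚ,f})`, is the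
diagonal image of `(q) ∈ GL_1(ℚ)⁺`. [folklore] -/
theorem scalar_unitEmbedding_eq_diagPos {q : ℚˣ} (hq : 0 < (q : ℚ)) :
    Matrix.GeneralLinearGroup.scalar (Fin 1) (FiniteAdeleRing.unitEmbedding (𝓞 ℚ) ℚ q) =
      diagPos 1 ⟨Matrix.GeneralLinearGroup.scalar (Fin 1) q, scalar_mem_glpos hq⟩ := by
  refine Matrix.GeneralLinearGroup.ext fun i j => ?_
  change _ = ((BigHeckeGLn.globalEmbedding 1 ℚ (Matrix.GeneralLinearGroup.scalar (Fin 1) q) :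
    BigHeckeGLn.FiniteAdelicGL 1 ℚ) : Matrix (Fin 1) (Fin 1) (FiniteAdeleRing (𝓞 ℚ) ℚ)) i j
  rw [coe_scalar_fin_one_apply, BigHeckeGLn.globalEmbedding,
    Matrix.GeneralLinearGroup.map_apply, coe_scalar_fin_one_apply]
  rfl

/-- The uniformiser idele of the fixed uniformiser at `v`, as a scalar in `GL_1(𝔸_{K,f})`, is the
Hecke element `t_{v,1}`. [folklore] -/
theorem scalar_uniformizerIdele_eq_heckeElement {K : Type} [Field K] [NumberField K]
    (v : HeightOneSpectrum (𝓞 K)) :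
    Matrix.GeneralLinearGroup.scalar (Fin 1) (uniformizerIdele K v (uniformizerAt v)) =
      BigHeckeGLn.heckeElement 1 K v 1 := by
  refine Matrix.GeneralLinearGroup.ext fun i j => ?_
  rw [coe_scalar_fin_one_apply, BigHeckeGLn.heckeElement, coe_glDiagonal, Subsingleton.elim i j,
    Matrix.diagonal_apply_eq, if_pos (by simp)]

/-- **`GL_1(𝔸_{ℚ,f}) = GL_1(ℚ)⁺ · K_f(N) · ⟨t_{v,1} : v ∤ N⟩`** (`N ≠ 0`): a subgroup of
`GL_1(𝔸_{ℚ,f})` containing the diagonally embedded positive rationals, the level `K_f(N)` and the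
Hecke elements `t_{v,1}` (the fixed uniformiser ideles) at the places `v ∤ N` is everything
(`finiteIdele_rat_subgroup_eq_top` transported along `u ↦ (u) ∈ GL_1`, every `g ∈ GL_1` being the
scalar `det g`, `generalLinearGroup_scalar_det_of_fin_one`).
[cite: CasselsFrohlichANT1967, Ch. VII §4 Prop. 4.1 (proof)] -/
theorem subgroup_finiteAdelicGL_one_eq_top {N : ℕ} (hN : N ≠ 0)
    (S : Subgroup (BigHeckeGLn.FiniteAdelicGL 1 ℚ))
    (hΓ : ∀ γ : Matrix.GLPos (Fin 1) ℚ, diagPos 1 γ ∈ S) (hL : level 1 N ≤ S)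
    (hT : ∀ v : HeightOneSpectrum (𝓞 ℚ), ¬ v.asIdeal ∣ Ideal.span {(N : 𝓞 ℚ)} →
      BigHeckeGLn.heckeElement 1 ℚ v 1 ∈ S) :
    S = ⊤ := by
  set 𝔣 : Ideal (𝓞 ℚ) := Ideal.span {(N : 𝓞 ℚ)} with h𝔣def
  have h𝔣b : 𝔣 ≠ ⊥ := by
    rw [Ne, h𝔣def, Ideal.span_singleton_eq_bot]
    exact_mod_cast hN
  have key := finiteIdele_rat_subgroup_eq_top h𝔣b
    (S.comap (Matrix.GeneralLinearGroup.scalar (Fin 1))) ?_ ?_ ?_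
  · refine eq_top_iff.2 fun g _ => ?_
    have hg : Matrix.GeneralLinearGroup.det g ∈
        S.comap (Matrix.GeneralLinearGroup.scalar (Fin 1)) := by
      rw [key]; exact Subgroup.mem_top _
    rw [Subgroup.mem_comap, generalLinearGroup_scalar_det_of_fin_one] at hg
    exact hg
  · -- positive rationals
    intro q hq
    rw [Subgroup.mem_comap, scalar_unitEmbedding_eq_diagPos hq]
    exact hΓ _
  · -- unit ideles `≡ 1 mod N`
    intro u hu1 hu2
    rw [Subgroup.mem_comap]
    exact hL (scalar_mem_level hN hu1 hu2)
  · -- uniformisers at `v ∤ N`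
    intro v hv
    have hdvd : ¬ v.asIdeal ∣ 𝔣 := fun h =>
      (modulusExp_ne_zero_iff 𝔣 h𝔣b v).2 (Ideal.le_of_dvd h) hv
    rw [Subgroup.mem_comap, scalar_uniformizerIdele_eq_heckeElement]
    exact hT v hdvd

/-- **The character of a rank-one Hecke eigenclass.** Let `x ∈ H⁰(S(K_f(N)), Ṽ_λ(k))`,
`λ = (λ₀)`, be a non-zero class which is an eigenvector of the Hecke operators `T_{v,1}` for all
`v ∤ N` (`N ≥ 1`). Then there is a character `χ : GL_1(𝔸_{ℚ,f}) → kˣ`, trivial on `K_f(N)`, with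
`χ(γ) = γ^{λ₀}` on the diagonally embedded `GL_1(ℚ)⁺`, such that every Hecke operator `T_g`,
`g ∈ GL_1(𝔸_{ℚ,f})`, acts on `x` by `χ(g)`: the invariant function `f` of `x` satisfies
`f(γ c) = γ^{λ₀} f(c)` (invariance for the twisted action), `f(c u) = f(c)` (`u ∈ K_f(N)`) and
`f(c t_{v,1}) = a_v f(c)` (`[K_f t_{v,1} K_f]` is translation by `t_{v,1}`,
`heckeFun_coe_of_comm`), and `GL_1(ℚ)⁺`, `K_f(N)` and the `t_{v,1}` generate `GL_1(𝔸_{ℚ,f})`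
(`subgroup_finiteAdelicGL_one_eq_top`). This is the finite part of the algebraic Hecke
character attached to `x` (Eichler–Shimura–Harder for `GL_1`: [RaghuramShahidi2010, §2.2],
`n = 1`). [cite: RaghuramShahidi2010, §2.2] -/
theorem exists_character_of_eigenclass_one (k : Type) [Field k] [CharZero k] {N : ℕ} (hN : 1 ≤ N)
    (wt : Fin 1 → ℤ) (x : levelCohomology k 1 N wt 0) (hx0 : x ≠ 0)
    (heig : ∀ v : HeightOneSpectrum (𝓞 ℚ), ¬ v.asIdeal ∣ Ideal.span {(N : 𝓞 ℚ)} →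
      ∃ c : k, heckeT k 1 N wt 0 v 1 x = c • x) :
    ∃ χ : BigHeckeGLn.FiniteAdelicGL 1 ℚ →* kˣ, (∀ u ∈ level 1 N, χ u = 1) ∧
      (∀ γ : Matrix.GLPos (Fin 1) ℚ, χ (diagPos 1 γ) =
        Matrix.GeneralLinearGroup.det (ratPointsToField k 1 (γ : GL (Fin 1) ℚ)) ^ lowestEntry wt) ∧
      ∀ g : BigHeckeGLn.FiniteAdelicGL 1 ℚ, heckeOp k 1 N wt 0 g x = ((χ g : kˣ) : k) • x := by
  classical
  have hN0 : N ≠ 0 := Nat.one_le_iff_ne_zero.mp hN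
  -- the invariant function of `x`
  set A : Rep k (Matrix.GLPos (Fin 1) ℚ) :=
    TwistedQuotient.coeffRep (V := CoeffModule k 1 wt) (diagPos 1) (level 1 N) (coeffRepPos k 1 wt)
    with hA
  set f : (BigHeckeGLn.FiniteAdelicGL 1 ℚ ⧸ level 1 N) → CoeffModule k 1 wt :=
    (((groupCohomology.H0Iso A).hom x : A.ρ.invariants) :
      (BigHeckeGLn.FiniteAdelicGL 1 ℚ ⧸ level 1 N) → CoeffModule k 1 wt) with hf
  have hfinv : ∀ γ,
      TwistedQuotient.coeffRepresentation (diagPos 1) (level 1 N) (coeffRepPos k 1 wt) γ f = f :=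
    TwistedQuotient.coeffRepresentation_H0Iso_hom (diagPos 1) (level 1 N) (coeffRepPos k 1 wt) x
  have hf0 : f ≠ 0 :=
    TwistedQuotient.H0Iso_hom_ne_zero (diagPos 1) (level 1 N) (coeffRepPos k 1 wt) hx0
  -- `GL_1(𝔸_{ℚ,f})` is commutative
  have hcomm : ∀ a b : BigHeckeGLn.FiniteAdelicGL 1 ℚ, a * b = b * a := fun a b => by
    refine Units.ext (Matrix.ext fun i j => ?_)
    rw [Subsingleton.elim i 0, Subsingleton.elim j 0]
    simp [Matrix.mul_apply, mul_comm]
  -- the generators and their scalars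
  set G : Set (BigHeckeGLn.FiniteAdelicGL 1 ℚ) :=
    (Set.range (diagPos 1) ∪ (level 1 N : Set (BigHeckeGLn.FiniteAdelicGL 1 ℚ))) ∪
      {t | ∃ v : HeightOneSpectrum (𝓞 ℚ), ¬ v.asIdeal ∣ Ideal.span {(N : 𝓞 ℚ)} ∧
        t = BigHeckeGLn.heckeElement 1 ℚ v 1} with hG'
  have hgen : Subgroup.closure G = ⊤ :=
    subgroup_finiteAdelicGL_one_eq_top hN0 (Subgroup.closure G)
      (fun γ => Subgroup.subset_closure (Or.inl (Or.inl ⟨γ, rfl⟩)))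
      (fun u hu => Subgroup.subset_closure (Or.inl (Or.inr hu)))
      (fun v hv => Subgroup.subset_closure (Or.inr ⟨v, hv, rfl⟩))
  have hG : ∀ g ∈ G, ∃ c : k, ∀ a : BigHeckeGLn.FiniteAdelicGL 1 ℚ,
      f ((a * g : BigHeckeGLn.FiniteAdelicGL 1 ℚ) : BigHeckeGLn.FiniteAdelicGL 1 ℚ ⧸ level 1 N) =
        c • f (a : BigHeckeGLn.FiniteAdelicGL 1 ℚ ⧸ level 1 N) := by
    rintro g ((⟨γ, rfl⟩ | hu) | ⟨v, hv, rfl⟩)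
    · refine ⟨((Matrix.GeneralLinearGroup.det (ratPointsToField k 1 (γ : GL (Fin 1) ℚ)) ^
        lowestEntry wt : kˣ) : k), fun a => ?_⟩
      have e : (diagPos 1 γ)⁻¹ * (a * diagPos 1 γ) = a := by
        rw [hcomm a, ← mul_assoc, inv_mul_cancel, one_mul]
      have h := congr_fun (hfinv γ)
        ((a * diagPos 1 γ : BigHeckeGLn.FiniteAdelicGL 1 ℚ) :
          BigHeckeGLn.FiniteAdelicGL 1 ℚ ⧸ level 1 N)
      rw [TwistedQuotient.coeffRepresentation_apply, coeffRepPos_one_apply,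
        MulAction.Quotient.smul_coe, smul_eq_mul, e] at h
      exact h.symm
    · exact ⟨1, fun a => by rw [one_smul, QuotientGroup.mk_mul_of_mem a hu]⟩
    · obtain ⟨c, hc⟩ := heig v hv
      refine ⟨c, fun a => ?_⟩
      have h := congr_fun (TwistedQuotient.heckeFun_H0Iso_hom_eq_smul (diagPos 1) (level 1 N)
        (coeffRepPos k 1 wt) hc) (a : BigHeckeGLn.FiniteAdelicGL 1 ℚ ⧸ level 1 N)
      rwa [ArithmeticQuotient.heckeFun_coe_of_comm hcomm, Pi.smul_apply] at h
  obtain ⟨χ, hχL, hχ, huniq⟩ :=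
    TwistedQuotient.exists_character_of_eigenfunction (level 1 N) f hf0 G hgen hG
  refine ⟨χ, hχL, fun γ => ?_, fun g => ?_⟩
  · obtain ⟨c, hc⟩ := hG (diagPos 1 γ) (Or.inl (Or.inl ⟨γ, rfl⟩))
    -- the scalar of `γ` is `det(γ)^{λ₀}`, by invariance
    refine Units.ext (huniq (diagPos 1 γ) _ fun a => ?_).symm
    have e : (diagPos 1 γ)⁻¹ * (a * diagPos 1 γ) = a := by
      rw [hcomm a, ← mul_assoc, inv_mul_cancel, one_mul]
    have h := congr_fun (hfinv γ)
      ((a * diagPos 1 γ : BigHeckeGLn.FiniteAdelicGL 1 ℚ) :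
        BigHeckeGLn.FiniteAdelicGL 1 ℚ ⧸ level 1 N)
    rw [TwistedQuotient.coeffRepresentation_apply, coeffRepPos_one_apply,
      MulAction.Quotient.smul_coe, smul_eq_mul, e] at h
    exact h.symm
  · -- `T_g x = χ(g) x`, checked on invariant functions
    have hinj : Function.Injective (groupCohomology.H0Iso A).hom :=
      (groupCohomology.H0Iso A).toLinearEquiv.injective
    refine hinj (Subtype.ext ?_)
    rw [map_smul]
    change ((groupCohomology.H0Iso A).hom (TwistedQuotient.heckeEnd (diagPos 1) (level 1 N)
        (coeffRepPos k 1 wt) g 0 x) : _ → CoeffModule k 1 wt) = ((χ g : kˣ) : k) • f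
    rw [TwistedQuotient.H0Iso_hom_heckeEnd]
    funext q
    induction q using QuotientGroup.induction_on with
    | H a =>
      rw [ArithmeticQuotient.heckeFun_coe_of_comm hcomm, Pi.smul_apply]
      exact hχ g a

end GLnCohomology


open scoped MatrixGroups Matrix NNReal
open NumberField.mixedEmbedding Filter
open _root_.Topology


open Literature.NumberTheory.GaloisRepresentations

/-! ### The algebraic Hecke character of `ℚ` with given finite part -/

section HeckeCharacterOfFinitePart

/-- `Rat.infReal` is the real embedding of the archimedean component (definitional). [folklore] -/
theorem Rat.infReal_eq_extensionEmbeddingOfIsReal (x : ideleGroup ℚ) :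
    Rat.infReal x = InfinitePlace.Completion.extensionEmbeddingOfIsReal Rat.isReal_infinitePlace
      ((x : AdeleRing (𝓞 ℚ) ℚ).1 Rat.infinitePlace) := rfl

/-- The archimedean component of the positive real idele `t ∈ A_G` is `t`. [folklore] -/
theorem Rat.infReal_posRealIdele (t : ℝ≥0ˣ) :
    Rat.infReal (posRealIdele ℚ t) = ((t : ℝ≥0) : ℝ) := by
  rw [Rat.infReal_eq_extensionEmbeddingOfIsReal, posRealIdele_fst]
  have h := congr_arg (fun z : mixedSpace ℚ => z.1 ⟨Rat.infinitePlace, Rat.isReal_infinitePlace⟩)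
    ((InfiniteAdeleRing.ringEquiv_mixedSpace ℚ).apply_symm_apply
      (algebraMap ℝ (mixedSpace ℚ) ((t : ℝ≥0) : ℝ)))
  simp only [InfiniteAdeleRing.ringEquiv_mixedSpace_apply] at h
  exact h

/-- **The Hecke character of `ℚ` with prescribed finite part and archimedean weight.** Let
`χ : (𝔸_{ℚ,f})^× → ℂ^×` be a character which is trivial on the unit ideles `≡ 1 mod N` (`N ≠ 0`)
and satisfies `χ(q) = q^w` on the positive rationals (`w ∈ ℤ`). Then
`θ(x) = |x_∞|^{-w} χ(sgn(x_∞) x_f)` is a Hecke character of `ℚ` (continuous: near `1` it is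
`x ↦ x_∞^{-w}`; trivial on `ℚ^×`: `θ(q) = |q|^{-w} χ(|q|) = 1`) with `θ((1, u)) = χ(u)` and
`θ((t, 1)) = t^{-w}` for `t > 0` — the algebraic Hecke character of infinity type `t ↦ t^{-w}`
whose finite part is `χ` (`𝕀_ℚ = ℚ^× × ℝ_{>0} × ẑ^×`). Weil (1956); Neukirch VII §6;
Tate (1950), §4.3. [cite: NeukirchANT1999, Ch. VII §6] -/
theorem exists_heckeCharacter_rat_of_finitePart {N : ℕ} (hN : N ≠ 0) (w : ℤ)
    (χ : (FiniteAdeleRing (𝓞 ℚ) ℚ)ˣ →* ℂˣ)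
    (hχQ : ∀ q : ℚˣ, 0 < (q : ℚ) →
      ((χ (FiniteAdeleRing.unitEmbedding (𝓞 ℚ) ℚ q) : ℂˣ) : ℂ) = ((q : ℚ) : ℂ) ^ w)
    (hχU : ∀ u : (FiniteAdeleRing (𝓞 ℚ) ℚ)ˣ,
      (∀ v, Valued.v ((u : FiniteAdeleRing (𝓞 ℚ) ℚ) v) = 1) →
      (∀ v, modulusExp (Ideal.span {(N : 𝓞 ℚ)}) v ≠ 0 →
        Valued.v ((u : FiniteAdeleRing (𝓞 ℚ) ℚ) v - 1) ≤
          WithZero.exp (-(modulusExp (Ideal.span {(N : 𝓞 ℚ)}) v : ℤ))) →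
      χ u = 1) :
    ∃ θ : HeckeCharacter ℚ,
      (∀ x : ideleGroup ℚ, (x : AdeleRing (𝓞 ℚ) ℚ).1 = 1 → θ x = χ (ideleGroup.finPart ℚ x)) ∧
      ∀ x : ideleGroup ℚ, (x : AdeleRing (𝓞 ℚ) ℚ).2 = 1 → 0 < Rat.infReal x →
        ((θ x : ℂˣ) : ℂ) = ((Rat.infReal x : ℝ) : ℂ) ^ (-w) := by
  set 𝔣 : Ideal (𝓞 ℚ) := Ideal.span {(N : 𝓞 ℚ)} with h𝔣def
  have h𝔣b : 𝔣 ≠ ⊥ := by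
    rw [Ne, h𝔣def, Ideal.span_singleton_eq_bot]
    exact_mod_cast hN
  -- the finite twist `ψ(x) = x_f · sgn(x_∞)`
  let ψ : ideleGroup ℚ →* (FiniteAdeleRing (𝓞 ℚ) ℚ)ˣ :=
    (ideleGroup.finPart ℚ) * ((FiniteAdeleRing.unitEmbedding (𝓞 ℚ) ℚ).comp Rat.infSign)
  have hψ : ∀ x, ψ x = ideleGroup.finPart ℚ x *
      FiniteAdeleRing.unitEmbedding (𝓞 ℚ) ℚ (Rat.infSign x) := fun x => rfl
  -- the archimedean factor `A(x) = |x_∞|^{-w}`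
  let A : ideleGroup ℚ → ℂ := fun x => ((|Rat.infReal x| : ℝ) : ℂ) ^ (-w)
  have hA : ∀ x, A x = ((|Rat.infReal x| : ℝ) : ℂ) ^ (-w) := fun x => rfl
  have hA0 : ∀ x, A x ≠ 0 := fun x =>
    zpow_ne_zero _ (Complex.ofReal_ne_zero.2 (abs_ne_zero.2 (Rat.infReal_ne_zero x)))
  have hAmul : ∀ x y, A (x * y) = A x * A y := fun x y => by
    simp only [hA, map_mul, abs_mul, Complex.ofReal_mul, mul_zpow]
  have hAcont : Continuous A :=
    (Complex.continuous_ofReal.comp (continuous_abs.comp Rat.continuous_infReal)).zpow₀ _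
      fun x => Or.inl (Complex.ofReal_ne_zero.2 (abs_ne_zero.2 (Rat.infReal_ne_zero x)))
  let Au : ideleGroup ℚ →* ℂˣ :=
    MonoidHom.mk' (fun x => Units.mk0 (A x) (hA0 x)) fun x y => Units.ext (hAmul x y)
  have hAu : ∀ x, ((Au x : ℂˣ) : ℂ) = A x := fun x => rfl
  have hAucont : Continuous Au := by
    refine Units.continuous_iff.2 ⟨hAcont, ?_⟩
    change Continuous fun x => ((Units.mk0 (A x) (hA0 x))⁻¹ : ℂ)
    simp only [Units.val_mk0]
    exact hAcont.inv₀ hA0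
  -- the finite factor is locally constant, hence continuous
  have hχψcont : Continuous (χ.comp ψ) := by
    refine continuous_of_continuousAt_one (χ.comp ψ) ?_
    have key : ∀ᶠ x in 𝓝 (1 : ideleGroup ℚ), χ.comp ψ x = 1 := by
      filter_upwards [congruenceIdeles_mem_nhds_one h𝔣b,
        (isOpen_unitIdeles ℚ).mem_nhds (unitIdeles ℚ).one_mem] with x hx hu
      have hpos : 0 < Rat.infReal x := hx.2 Rat.infinitePlace Rat.isReal_infinitePlace
      have hsgn : Rat.infSign x = 1 := by rw [Rat.infSign_apply, if_pos hpos]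
      rw [MonoidHom.comp_apply, hψ, hsgn, map_one, mul_one]
      exact hχU _ (fun v => hu v) (fun v hv => hx.1 v hv)
    rw [ContinuousAt, map_one]
    exact tendsto_const_nhds.congr' (key.mono fun x hx => hx.symm)
  -- the character
  let θ₀ : ideleGroup ℚ →* ℂˣ := Au * χ.comp ψ
  have hθ₀ : ∀ x, θ₀ x = Au x * χ (ψ x) := fun x => rfl
  have hθ₀cont : Continuous θ₀ := by
    change Continuous fun x => θ₀ x
    simp only [hθ₀]
    exact hAucont.mul hχψcont
  -- triviality on `ℚ^×`
  have hfinPart : ∀ q : ℚˣ, ideleGroup.finPart ℚ (GaloisRepresentations.principalIdele ℚ q) =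
      FiniteAdeleRing.unitEmbedding (𝓞 ℚ) ℚ q := fun q => Units.ext rfl
  have hprinc : ∀ q : ℚˣ, θ₀ (GaloisRepresentations.principalIdele ℚ q) = 1 := by
    intro q
    refine Units.ext ?_
    rw [hθ₀, Units.val_mul, hAu, hA, Rat.infReal_principalIdele, hψ, hfinPart, ← map_mul,
      Units.val_one]
    rcases lt_or_gt_of_ne (Rat.cast_ne_zero.2 q.ne_zero : ((q : ℚ) : ℝ) ≠ 0) with hq | hq
    · -- `q < 0`
      have hq' : (q : ℚ) < 0 := by exact_mod_cast hq
      have hsgn : Rat.infSign (GaloisRepresentations.principalIdele ℚ q) = -1 := by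
        rw [Rat.infSign_apply, Rat.infReal_principalIdele, if_neg hq.not_gt]
      have hpos : 0 < ((q * -1 : ℚˣ) : ℚ) := by
        rw [Units.val_mul, Units.val_neg, Units.val_one, mul_neg_one]
        exact neg_pos.2 hq'
      rw [hsgn, hχQ _ hpos, abs_of_neg hq, Units.val_mul, Units.val_neg, Units.val_one,
        mul_neg_one, Rat.cast_neg, ← Complex.ofReal_ratCast, Complex.ofReal_neg,
        ← zpow_add₀ (neg_ne_zero.2 (Complex.ofReal_ne_zero.2 (ne_of_lt hq))), neg_add_cancel,
        zpow_zero]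
    · -- `q > 0`
      have hq' : (0 : ℚ) < q := by exact_mod_cast hq
      have hsgn : Rat.infSign (GaloisRepresentations.principalIdele ℚ q) = 1 := by
        rw [Rat.infSign_apply, Rat.infReal_principalIdele, if_pos hq]
      rw [hsgn, mul_one, hχQ _ hq', abs_of_pos hq, ← Complex.ofReal_ratCast,
        ← zpow_add₀ (Complex.ofReal_ne_zero.2 (ne_of_gt hq)), neg_add_cancel, zpow_zero]
  let θ : HeckeCharacter ℚ :=
    { toContinuousMonoidHom := { θ₀ with continuous_toFun := hθ₀cont }
      map_principal' := by
        rintro x ⟨q, rfl⟩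
        exact hprinc q }
  have hθ : ∀ x, θ x = θ₀ x := fun x => rfl
  refine ⟨θ, fun x hx1 => ?_, fun x hx2 hpos => ?_⟩
  · -- `x_∞ = 1`
    have hinf : Rat.infReal x = 1 := by
      rw [Rat.infReal_eq_extensionEmbeddingOfIsReal, hx1]
      exact map_one _
    have hsgn : Rat.infSign x = 1 := by rw [Rat.infSign_apply, hinf, if_pos one_pos]
    refine Units.ext ?_
    rw [hθ, hθ₀, Units.val_mul, hAu, hA, hinf, hψ, hsgn, map_one, mul_one, abs_one,
      Complex.ofReal_one, one_zpow, one_mul]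
  · -- `x_f = 1`, `x_∞ > 0`
    have hsgn : Rat.infSign x = 1 := by rw [Rat.infSign_apply, if_pos hpos]
    have hfin : ideleGroup.finPart ℚ x = 1 := Units.ext hx2
    rw [hθ, hθ₀, Units.val_mul, hAu, hA, hψ, hsgn, hfin, map_one, mul_one, map_one, Units.val_one,
      mul_one, abs_of_pos hpos]

end HeckeCharacterOfFinitePart

/-! ### Small adelic identities in rank one -/

section RankOneIdentities

variable {K : Type} [Field K] [NumberField K]

/-- The archimedean component of `det (1, h)` is `1`. [folklore] -/
theorem fst_det_ofFinite_one (h : BigHeckeGLn.FiniteAdelicGL 1 K) :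
    ((Matrix.GeneralLinearGroup.det (GLn.ofFinite 1 K h) : (AdeleRing (𝓞 K) K)ˣ) :
      AdeleRing (𝓞 K) K).1 = 1 := by
  rw [Matrix.GeneralLinearGroup.val_det_apply, Matrix.det_fin_one, GLn.coe_ofFinite_apply,
    Matrix.one_apply_eq]

/-- The finite part of `det (1, h)` is `det h`. [folklore] -/
theorem finPart_det_ofFinite_one (h : BigHeckeGLn.FiniteAdelicGL 1 K) :
    ideleGroup.finPart K (Matrix.GeneralLinearGroup.det (GLn.ofFinite 1 K h)) =
      Matrix.GeneralLinearGroup.det h := by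
  refine Units.ext ?_
  change ((Matrix.GeneralLinearGroup.det (GLn.ofFinite 1 K h) : (AdeleRing (𝓞 K) K)ˣ) :
    AdeleRing (𝓞 K) K).2 = _
  rw [Matrix.GeneralLinearGroup.val_det_apply, Matrix.det_fin_one, GLn.coe_ofFinite_apply,
    Matrix.GeneralLinearGroup.val_det_apply, Matrix.det_fin_one]

/-- The finite part of the local idele `⟨u⟩_v` is the finite idele `(u at v, 1 elsewhere)` (both
are Mathlib's `RestrictedProduct.mulSingle`; definitional). [folklore] -/
theorem finPart_localUnits (v : HeightOneSpectrum (𝓞 K)) (u : (v.adicCompletion K)ˣ) :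
    ideleGroup.finPart K (localUnits v u) = uniformizerIdele K v u :=
  rfl

/-- `det` of the positive real scalar `t ∈ A_G ≤ GL_1(𝔸_K)` is the positive real idele `t`.
[folklore] -/
theorem det_posRealScalar_one (t : ℝ≥0ˣ) :
    Matrix.GeneralLinearGroup.det (posRealScalar 1 K t) = posRealIdele K t := by
  rw [posRealScalar, MonoidHom.comp_apply, Matrix.GeneralLinearGroup.det_scalar, Fintype.card_fin,
    pow_one]

/-- `t_{v,0} = 1` for the finite-adelic Hecke elements. [folklore] -/
theorem BigHeckeGLn.heckeElement_zero (n : ℕ) (v : HeightOneSpectrum (𝓞 K)) :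
    BigHeckeGLn.heckeElement n K v 0 = 1 := by
  have h : (fun k : Fin n => if k.val < 0 then uniformizerIdele K v (BigHeckeGLn.uniformizerAt v)
      else 1) = 1 := funext fun k => by simp
  rw [BigHeckeGLn.heckeElement, h, map_one]

/-- For `n = 1` every automorphic representation datum is cuspidal (the cusp conditions are
empty; Borel–Jacquet 1979, 4.4 — the tree's `cuspFormsGL_one_eq` of `TunnellCubicLifts`, re-proved
to keep the imports of this file small). [cite: BorelJacquet1979, 4.4] -/
private theorem W_le_cuspFormsGL_one' {h : isCompact_glFiniteIntegralLevel 1 K}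
    (τ : AutomorphicRepData (AutomorphyDatum.gl 1 K h)) : τ.W ≤ cuspFormsGL 1 K h := by
  have e : cuspFormsGL 1 K h = automorphicForms (AutomorphyDatum.gl 1 K h) := by
    unfold cuspFormsGL automorphicForms
    congr 1
    ext φ
    simp only [Set.mem_setOf_eq, IsCuspFormGL, and_iff_left_iff_imp]
    intro _ k hk hk1
    exact absurd hk1 (by omega)
  rw [e]
  exact τ.stable.le_automorphicForms

end RankOneIdentities

/-! ### Assembly: the rank-one case of `interiorEigenclass_isCuspidal` -/

section Assembly

open GLnCohomology Literature.NumberTheory.DiophantineGeometry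
open BigHeckeGLn (uniformizerAt)

/-- **`interiorEigenclass_isCuspidal` in rank one.** For `N ≥ 1`, a weight `λ = (λ₀)` and a
non-zero class `x ∈ H⁰(S(K_f(N)), Ṽ_λ ⊗ ℂ)` (`= CuspidalCohomologyGL 1 N λ`, `b_1 = 0`) which is
an eigenvector of the `T_{v,i}`, `v ∤ N`, `i ≤ 1`, there is a cuspidal automorphic representation
`π` of `GL₁(𝔸_ℚ)` of infinity type `cohomologicalInfinityType 1 ℚ λ^∨` with a `K(N)`-fixed vector
whose Satake parameters give the eigenvalues of `x`.  Proof: `x` is acted on by all `T_g` through a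
character `χ` of `GL₁(𝔸_{ℚ,f})`, trivial on `K_f(N)`, with `χ(γ) = γ^{λ₀}` on `GL₁(ℚ)⁺`
(`exists_character_of_eigenclass_one`); `θ(x) = |x_∞|^{-λ₀} χ(sgn(x_∞) x_f)` is an idèle class
character of `ℚ` (`exists_heckeCharacter_rat_of_finitePart`); `π = ℂ · (θ ∘ det) / ⊥`
(`exists_automorphicRepData_detTwist_glOne`, Borel–Jacquet 4.6) is cuspidal (empty cusp condition),
`θ ∘ det` is `K(N)`-fixed, its Satake parameter at `v ∤ N` is `{θ(⟨ϖ_v⟩)} = {χ(t_{v,1})}`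
(`hasSatakeParamAt_detTwist_glOne`), and `1 ∈ 𝔤𝔩₁(ℝ)` acts on it by the derivative `-λ₀` of
`t ↦ θ((t, 1)) = t^{-λ₀}`, which is the `a`-exponent `λ^∨₀ + ρ₀` of
`cohomologicalInfinityType 1 ℚ λ^∨` (`hasArchParameter_glOne_of_eq_smul_one`).  This is the case
`n = 1` of [Kishore2020, §5–§6] / [RaghuramShahidi2010, §2.2] (Eichler–Shimura–Harder: `H⁰` of the
ray class set is spanned by algebraic Hecke characters). [cite: RaghuramShahidi2010, §2.2] -/
theorem GLnCohomology.interiorEigenclass_isCuspidal_rank_one (N : ℕ) (hN : 1 ≤ N)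
    (hc : isCompact_glFiniteIntegralLevel 1 ℚ) (wt : Fin 1 → ℤ)
    (x : levelCohomology ℂ 1 N wt (bottomDegree 1)) (hx0 : x ≠ 0)
    (heig : ∀ v : HeightOneSpectrum (𝓞 ℚ), ¬ v.asIdeal ∣ Ideal.span {(N : 𝓞 ℚ)} →
      ∀ i ≤ 1, ∃ c : ℂ, heckeT ℂ 1 N wt (bottomDegree 1) v i x = c • x) :
    ∃ π : CuspidalAutomorphicRepData 1 ℚ hc,
      π.1.HasInfinityType
          (Literature.Barriers.Langlands.cohomologicalInfinityType 1 ℚ (Weight.dual wt)) ∧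
      (∃ φ ∈ π.1.W, φ ∉ π.1.W' ∧
        ∀ u ∈ principalCongruenceLevel 1 ℚ (Ideal.span {(N : 𝓞 ℚ)}),
          rightTranslation (AdelicGroupData.gl 1 ℚ) u φ = φ) ∧
      ∀ v : HeightOneSpectrum (𝓞 ℚ), ¬ v.asIdeal ∣ Ideal.span {(N : 𝓞 ℚ)} →
        ∃ α : Multiset ℂ, π.1.HasSatakeParamAt v α ∧ IsSatakeEigenclassAt x v α := by
  have hN0 : N ≠ 0 := Nat.one_le_iff_ne_zero.mp hN
  set 𝔣 : Ideal (𝓞 ℚ) := Ideal.span {(N : 𝓞 ℚ)} with h𝔣def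
  have h𝔣b : 𝔣 ≠ ⊥ := by
    rw [Ne, h𝔣def, Ideal.span_singleton_eq_bot]
    exact_mod_cast hN0
  have h𝔣0 : 𝔣 ≠ 0 := by rwa [Ne, Ideal.zero_eq_bot]
  -- Step 1: the character of the eigenclass
  obtain ⟨χ, hχL, hχΓ, hχT⟩ := exists_character_of_eigenclass_one ℂ hN wt x hx0
    (fun v hv => heig v hv 1 le_rfl)
  -- Step 2: the finite-idele character and its Hecke character
  set χ' : (FiniteAdeleRing (𝓞 ℚ) ℚ)ˣ →* ℂˣ :=
    χ.comp (Matrix.GeneralLinearGroup.scalar (Fin 1)) with hχ'def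
  have hχ' : ∀ u, χ' u = χ (Matrix.GeneralLinearGroup.scalar (Fin 1) u) := fun u => rfl
  have hχ'Q : ∀ q : ℚˣ, 0 < (q : ℚ) →
      ((χ' (FiniteAdeleRing.unitEmbedding (𝓞 ℚ) ℚ q) : ℂˣ) : ℂ) = ((q : ℚ) : ℂ) ^ (wt 0) := by
    intro q hq
    rw [hχ', scalar_unitEmbedding_eq_diagPos hq, hχΓ, Units.val_zpow_eq_zpow_val,
      Matrix.GeneralLinearGroup.val_det_apply, Matrix.det_fin_one, lowestEntry_succ]
    change (algebraMap ℚ ℂ (((Matrix.GeneralLinearGroup.scalar (Fin 1) q : GL (Fin 1) ℚ) :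
      Matrix (Fin 1) (Fin 1) ℚ) 0 0)) ^ wt (Fin.last 0) = _
    rw [coe_scalar_fin_one_apply, eq_ratCast]
    rfl
  have hχ'U : ∀ u : (FiniteAdeleRing (𝓞 ℚ) ℚ)ˣ,
      (∀ v, Valued.v ((u : FiniteAdeleRing (𝓞 ℚ) ℚ) v) = 1) →
      (∀ v, modulusExp 𝔣 v ≠ 0 →
        Valued.v ((u : FiniteAdeleRing (𝓞 ℚ) ℚ) v - 1) ≤ WithZero.exp (-(modulusExp 𝔣 v : ℤ))) →
      χ' u = 1 := fun u h1 h2 => by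
    rw [hχ']
    exact hχL _ (scalar_mem_level hN0 h1 h2)
  obtain ⟨θ, hθf, hθinf⟩ := exists_heckeCharacter_rat_of_finitePart hN0 (wt 0) χ' hχ'Q hχ'U
  have hθfin : ∀ h : BigHeckeGLn.FiniteAdelicGL 1 ℚ,
      θ (Matrix.GeneralLinearGroup.det (GLn.ofFinite 1 ℚ h)) = χ h := fun h => by
    rw [hθf _ (fst_det_ofFinite_one h), finPart_det_ofFinite_one, hχ',
      generalLinearGroup_scalar_det_of_fin_one]
  -- Step 3: the automorphic representation `π = ℂ · (θ ∘ det) / ⊥`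
  obtain ⟨π, hW, hW'⟩ := exists_automorphicRepData_detTwist_glOne (hcpt := hc) θ
  set ψθ : (AdelicGroupData.gl 1 ℚ).Adelic → ℂ := fun g => (Automorphic.detTwist 1 θ g : ℂ) with hψθ
  have hψθ0 : ψθ ≠ 0 := fun h => by
    have h1 := congrFun h 1
    simp only [hψθ, map_one, Units.val_one, Pi.zero_apply] at h1
    exact one_ne_zero h1
  have hψθW : ψθ ∈ π.W := by
    rw [hW]
    exact Submodule.mem_span_singleton_self _
  have hψθW' : ψθ ∉ π.W' := by
    rw [hW', Submodule.mem_bot]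
    exact hψθ0
  -- the level: `θ ∘ det` is trivial on `K(N) = {1} × K_f(N)`
  have hθN : ∀ k ∈ principalCongruenceLevel 1 ℚ 𝔣, Automorphic.detTwist 1 θ k = 1 := by
    intro k hk
    rw [← map_ofFinite_finitePrincipalCongruenceLevel] at hk
    obtain ⟨k', hk', rfl⟩ := Subgroup.mem_map.1 hk
    rw [Automorphic.detTwist_apply', hθfin k']
    exact hχL k' hk'
  refine ⟨⟨π, W_le_cuspFormsGL_one' π⟩, ?_, ⟨ψθ, hψθW, hψθW', fun u hu => ?_⟩, fun v hv => ?_⟩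
  · -- Step 4: the infinity type
    haveI := isEmpty_isComplex_rat
    obtain ⟨δ, hδ⟩ := exists_linearMap_detTwist_ofArch_expMem_glOne hc θ
    obtain ⟨ρ𝔤, hρ⟩ := π.exists_hasLieAction_gl
    obtain ⟨d, hd⟩ := π.exists_linearMap_lieAction_eq_smul_one_glOne ρ𝔤
    let w₀ : {w : InfinitePlace ℚ // w.IsReal} := ⟨Rat.infinitePlace, Rat.isReal_infinitePlace⟩
    set X₁ : (AutomorphyDatum.gl 1 ℚ hc).arch.lie := ⟨realPlaceLie 1 w₀ 1, trivial⟩ with hX₁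
    have hX : X₁ = (⟨1, trivial⟩ : (AutomorphyDatum.gl 1 ℚ hc).arch.lie) :=
      Subtype.ext (realPlaceLie_one_one_rat w₀)
    -- the archimedean parameter read off `d`
    have hχarch : π.HasArchParameter fun _ => {d X₁} :=
      π.hasArchParameter_glOne_of_eq_smul_one hρ d hd
        (fun w => by rw [Subsingleton.elim w w₀]) (fun w => isEmptyElim w)
    -- `d X₁ = δ X₁`: the Lie algebra acts on `θ ∘ det` by `δ`, and `W' = ⊥`
    have hdδ : d X₁ = δ X₁ := by
      have hq : π.mkQ (π.lieDerivW X₁ ⟨ψθ, hψθW⟩) = π.mkQ (d X₁ • ⟨ψθ, hψθW⟩) := by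
        rw [← hρ X₁ ⟨ψθ, hψθW⟩, hd X₁, map_smul]
        rfl
      have hmem : π.lieDerivW X₁ ⟨ψθ, hψθW⟩ - d X₁ • ⟨ψθ, hψθW⟩ ∈ π.kerQuot :=
        (Submodule.Quotient.eq _).mp hq
      have h0 : lieDeriv (AutomorphyDatum.gl 1 ℚ hc).ofArch X₁ ψθ - d X₁ • ψθ ∈ π.W' := hmem
      rw [hW', Submodule.mem_bot, hψθ, lieDeriv_detTwist_glOne hc θ hδ X₁, ← sub_smul,
        smul_eq_zero] at h0
      rcases h0 with h0 | h0
      · exact (sub_eq_zero.1 h0).symm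
      · exact absurd h0 hψθ0
    -- `δ(1) = -λ₀`: on `A_G`, `θ((t, 1)) = t^{-λ₀}`
    have hδ1 : δ (⟨1, trivial⟩ : (AutomorphyDatum.gl 1 ℚ hc).arch.lie) = -((wt 0 : ℤ) : ℂ) := by
      refine eq_of_forall_exp_mul_eq fun s => ?_
      set t : ℝ≥0ˣ := Units.mk0 ⟨Real.exp s, (Real.exp_pos s).le⟩
        (ne_of_gt (NNReal.coe_pos.mp (Real.exp_pos s))) with ht
      have htR : ((t : ℝ≥0) : ℝ) = Real.exp s := rfl
      have hlog : Real.log ((t : ℝ≥0) : ℝ) = s := by rw [htR, Real.log_exp]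
      have htpos : 0 < Rat.infReal (posRealIdele ℚ t) := by
        rw [Rat.infReal_posRealIdele, htR]
        exact Real.exp_pos s
      have h1 :=
        hδ (Real.log ((t : ℝ≥0) : ℝ) • (⟨1, trivial⟩ : (AutomorphyDatum.gl 1 ℚ hc).arch.lie))
      rw [← posRealScalar_eq_ofArch_expMem (hcpt := hc) t, map_smul, hlog] at h1
      change ((θ (Matrix.GeneralLinearGroup.det (posRealScalar 1 ℚ t)) : ℂˣ) : ℂ) = _ at h1
      rw [det_posRealScalar_one, hθinf _ (posRealIdele_snd ℚ t) htpos, Rat.infReal_posRealIdele,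
        htR, Complex.ofReal_exp, Complex.real_smul, ← Complex.exp_int_mul] at h1
      rw [mul_comm (δ _) (s : ℂ), ← h1, Int.cast_neg]
    have hpar : (fun σ : ℚ →+* ℂ => ((Literature.Barriers.Langlands.cohomologicalInfinityType 1 ℚ
        (Weight.dual wt) σ).map ArchWeight.a)) = fun _ => {d X₁} := by
      funext σ
      rw [Literature.Barriers.Langlands.cohomologicalInfinityType_apply, Multiset.map_map, hdδ, hX,
        hδ1, Finset.univ_unique, Finset.singleton_val, Multiset.map_singleton, Function.comp_apply,
        Literature.Barriers.Langlands.cohomologicalArchWeight_a, rhoGL_one, add_zero]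
      change ({(((-wt (Fin.rev 0) : ℤ)) : ℂ)} : Multiset ℂ) = {-((wt 0 : ℤ) : ℂ)}
      rw [Int.cast_neg]
      rfl
    refine ⟨Literature.Barriers.Langlands.isWellFormed_cohomologicalInfinityType 1 ℚ
      (Weight.dual wt), ?_⟩
    rw [hpar]
    exact hχarch
  · -- Step 5: `θ ∘ det` is `K(N)`-fixed
    rw [hψθ, rightTranslation_detTwist_glOne, hθN u hu, Units.val_one, one_smul]
  · -- Step 6: Satake parameters and eigenvalues at `v ∤ N`
    refine ⟨{((θ (localUnits v (uniformizerAt v)) : ℂˣ) : ℂ)},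
      AutomorphicRepData.hasSatakeParamAt_detTwist_glOne hc hW hW' h𝔣0 hθN v hv
        (BigHeckeGLn.valued_uniformizerAt v), fun i hi => ?_⟩
    change heckeOp ℂ 1 N wt 0 (BigHeckeGLn.heckeElement 1 ℚ v i) x = _
    rw [hχT]
    congr 1
    rcases Nat.le_one_iff_eq_zero_or_eq_one.1 hi with rfl | rfl
    · rw [BigHeckeGLn.heckeElement_zero, map_one, Units.val_one, satakeEigenvalue]
      simp [Multiset.esymm]
    · rw [← scalar_uniformizerIdele_eq_heckeElement, ← hχ', ← finPart_localUnits,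
        ← hθf _ (localUnits_fst v (uniformizerAt v)), satakeEigenvalue]
      simp [Multiset.esymm, Multiset.powersetCard_one]

/-- **The named fact `interiorEigenclass_isCuspidal` with `n = 1`**, binders exactly as in the
fact (the dominance and regularity hypotheses and the interiority of `x` — automatic in rank one,
`cuspidalCohomologyGL_one_eq_top` — are vacuous and unused). [cite: RaghuramShahidi2010, §2.2] -/
theorem GLnCohomology.interiorEigenclass_isCuspidal_one :
    ∀ (N : ℕ), 1 ≤ 1 → 1 ≤ N → ∀ (hc : isCompact_glFiniteIntegralLevel 1 ℚ) (wt : Fin 1 → ℤ),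
      Weight.IsDominant wt → (StrictAnti wt ∨ 1 ≤ 2) →
      ∀ x ∈ CuspidalCohomologyGL 1 N wt, x ≠ 0 →
        (∀ v : HeightOneSpectrum (𝓞 ℚ), ¬ v.asIdeal ∣ Ideal.span {(N : 𝓞 ℚ)} →
          ∀ i ≤ 1, ∃ c : ℂ, heckeT ℂ 1 N wt (bottomDegree 1) v i x = c • x) →
        ∃ π : CuspidalAutomorphicRepData 1 ℚ hc,
          π.1.HasInfinityType
              (Literature.Barriers.Langlands.cohomologicalInfinityType 1 ℚ (Weight.dual wt)) ∧
          (∃ φ ∈ π.1.W, φ ∉ π.1.W' ∧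
            ∀ u ∈ principalCongruenceLevel 1 ℚ (Ideal.span {(N : 𝓞 ℚ)}),
              rightTranslation (AdelicGroupData.gl 1 ℚ) u φ = φ) ∧
          ∀ v : HeightOneSpectrum (𝓞 ℚ), ¬ v.asIdeal ∣ Ideal.span {(N : 𝓞 ℚ)} →
            ∃ α : Multiset ℂ, π.1.HasSatakeParamAt v α ∧ IsSatakeEigenclassAt x v α :=
  fun N _ hN hc wt _ _ x _ hx0 heig => interiorEigenclass_isCuspidal_rank_one N hN hc wt x hx0 heig

end Assembly

end Literature.NumberTheory.Automorphic
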